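import Literature.NumberTheory.CubicFields.SingularZeroModP
import HarnessLib

/-!
# Discriminants of maximal binary cubic forms: `p³ ∤ Disc` for `p ≥ 5`, `2⁴ ∤ Disc`, `3⁶ ∤ Disc`

Topic `Literature/NumberTheory/CubicFields`, continuing `DavenportHeilbronnMaximality.lean` (the
Davenport–Heilbronn sets `U_p`, BTT 2023 Prop. 2.2: maximal `R(f)` ⇒ `f ∈ U_p` for all `p`) and
`SingularZeroModP.lean` (if `p ∣ Disc f`, `p ∤ f`, a `GL₂(ℤ)`-translate of `f` has `p ∣ a, p ∣ b`).

Davenport–Heilbronn 1971, §§2–3 (`U_p ⊂ V_p`): a form `f ∈ U_p` has `p² ∤ D(f)` unless `f` is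
congruent to a constant times the cube of a linear form modulo `p`, in which case `p² ∥ D(f)` for
`p ≠ 3`. Classically (Hasse 1930) the discriminant of a cubic field — the discriminant of its
maximal order, an everywhere-maximal form — has `v_p ≤ 2` for `p ≥ 5`, `v_2 ≤ 3`, `v_3 ≤ 5`
(Taniguchi–Thorne 2013, §6.2: "for `p > 3` there are no cubic fields with discriminants divisible by
`p³` … discriminants of cubic fields can have 3-adic valuation as large as 5"). This file PROVES
these bounds for every `f ∈ U_p`: after `SingularZeroModP` a translate `g ~ f` has `p ∥ a` (`p² ∤ a`
is `U_p`), `p ∣ b`, and the valuation is read off `Disc = b²c² − 4ac³ − 4b³d − 27a²d² + 18abcd`: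

* `BinaryCubic.not_sq_dvd_disc_of_not_dvd_c` (`p` odd, `p ∤ c`: `p² ∤ Disc`),
  `not_two_pow_four_dvd_disc` (`p = 2`, `2 ∤ c`: `2⁴ ∤ Disc`, by exhaustion mod `4`),
  `not_cube_dvd_disc_of_dvd_c` (`p ≠ 3`, `p ∣ c`: `p³ ∤ Disc`),
  `not_three_pow_six_dvd_disc` (`p = 3`, `3 ∣ c`: `3⁶ ∤ Disc`, a three-step descent);
* **`BinaryCubic.not_pow_dvd_disc_of_memU`** — for `f ∈ U_p`: `p ^ (if p = 2 then 4 else if p = 3 then 6 else 3) ∤ Disc f`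
  with `maxDiscExponent = 4, 6, 3` at `p = 2`, `p = 3`, `p ≥ 5`; `disc_ne_zero_of_memU`;
* `RingOfForm.IsMaximal.not_pow_dvd_disc`, `…_natAbs_disc`, `IsMaximal.disc_ne_zero` — the same
  for maximal cubic rings `R(f)` (BTT Prop. 2.2).

All statements are proved; nothing is a named fact. NOT here: the exact valuation in the totally
ramified case, the sets `V_p`, local densities.

## References

* H. Davenport, H. Heilbronn, *On the density of discriminants of cubic fields. II*, Proc. Roy.
  Soc. London A 322 (1971) 405–420, §§2–3 [DavenportHeilbronn1971].
* M. Bhargava, T. Taniguchi, F. Thorne, *Improved error estimates for the Davenport–Heilbronn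
  theorems*, Math. Ann. 389 (2024) = arXiv:2107.12819, Prop. 2.2 [BhargavaTaniguchiThorne2023].
* T. Taniguchi, F. Thorne, *Secondary terms in counting functions for cubic fields*, Duke Math. J.
  162 (2013) = arXiv:1102.2914, §6.2 [TaniguchiThorne2013].
-/

namespace Literature.NumberTheory.CubicFields

namespace BinaryCubic

variable {f : BinaryCubic ℤ} {p : ℕ}

/-! ### Valuations of the discriminant for `f ∈ U_p` -/

/-- Exhaustion over `ℤ/4`: with `a₁, c` odd, `b₁²c² − 2a₁c³ − 8b₁³d − 27a₁²d² + 18a₁b₁cd ≢ 0 (mod 4)`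
(the case `2 ∥ a`, `2 ∣ b`, `2 ∤ c` of `2⁴ ∤ Disc`). [folklore] -/
private theorem ne_zero_zmod_four : ∀ a₁ b₁ c d : ZMod 4, 2 * a₁ ≠ 0 → 2 * c ≠ 0 →
    b₁ ^ 2 * c ^ 2 - 2 * a₁ * c ^ 3 - 8 * b₁ ^ 3 * d - 27 * a₁ ^ 2 * d ^ 2 + 18 * a₁ * b₁ * c * d ≠ 0 := by
  decide

/-- The case `p ∥ a`, `p ∣ b`, `p ∤ c` for odd `p`: `p² ∤ Disc`. [folklore] -/
theorem not_sq_dvd_disc_of_not_dvd_c (hp : p.Prime) (hp2 : p ≠ 2) {g : BinaryCubic ℤ}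
    (ha : (p : ℤ) ∣ g.a) (ha2 : ¬ (p : ℤ) ^ 2 ∣ g.a) (hb : (p : ℤ) ∣ g.b) (hc : ¬ (p : ℤ) ∣ g.c) :
    ¬ (p : ℤ) ^ 2 ∣ g.disc := by
  have hp' : Prime (p : ℤ) := Nat.prime_iff_prime_int.mp hp
  obtain ⟨a₁, ha₁⟩ := ha
  have ha₁' : ¬ (p : ℤ) ∣ a₁ := fun h => ha2 (by rw [ha₁, pow_two]; exact mul_dvd_mul_left _ h)
  intro hD
  -- `Disc = a·X + b²·Y`
  have hX : (p : ℤ) ^ 2 ∣ g.a * (-4 * g.c ^ 3 - 27 * g.a * g.d ^ 2 + 18 * g.b * g.c * g.d) := by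
    have : g.a * (-4 * g.c ^ 3 - 27 * g.a * g.d ^ 2 + 18 * g.b * g.c * g.d) =
        g.disc - g.b ^ 2 * (g.c ^ 2 - 4 * g.b * g.d) := by rw [disc_eq]; ring
    rw [this]
    exact dvd_sub hD (dvd_mul_of_dvd_left (pow_dvd_pow_of_dvd hb 2) _)
  rw [ha₁, pow_two, mul_assoc] at hX
  have hX' : (p : ℤ) ∣ a₁ * (-4 * g.c ^ 3 - 27 * (p * a₁) * g.d ^ 2 + 18 * g.b * g.c * g.d) :=
    (mul_dvd_mul_iff_left hp'.ne_zero).mp hX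
  rcases hp'.dvd_or_dvd hX' with h | h
  · exact ha₁' h
  · have h4 : (p : ℤ) ∣ 4 * g.c ^ 3 := by
      have : 4 * g.c ^ 3 = (-27 * (p * a₁) * g.d ^ 2 + 18 * g.b * g.c * g.d) -
          (-4 * g.c ^ 3 - 27 * (p * a₁) * g.d ^ 2 + 18 * g.b * g.c * g.d) := by ring
      rw [this]
      refine dvd_sub (dvd_add ⟨-27 * a₁ * g.d ^ 2, by ring⟩ ?_) h
      exact dvd_mul_of_dvd_left (dvd_mul_of_dvd_left (dvd_mul_of_dvd_right hb 18) _) _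
    rcases hp'.dvd_or_dvd h4 with h4 | h4
    · have h22 : (p : ℤ) ∣ 2 * 2 := by simpa [show (4 : ℤ) = 2 * 2 by norm_num] using h4
      rcases hp'.dvd_or_dvd h22 with h2 | h2 <;>
      · have := Int.le_of_dvd (by norm_num) h2
        have := hp.two_le
        omega
    · exact hc (hp'.dvd_of_dvd_pow h4)

/-- The case `2 ∥ a`, `2 ∣ b`, `2 ∤ c`: `2⁴ ∤ Disc`. [folklore] -/
theorem not_two_pow_four_dvd_disc {g : BinaryCubic ℤ} (ha : (2 : ℤ) ∣ g.a) (ha2 : ¬ (2 : ℤ) ^ 2 ∣ g.a)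
    (hb : (2 : ℤ) ∣ g.b) (hc : ¬ (2 : ℤ) ∣ g.c) : ¬ (2 : ℤ) ^ 4 ∣ g.disc := by
  obtain ⟨a₁, ha₁⟩ := ha
  obtain ⟨b₁, hb₁⟩ := hb
  have ha₁' : ¬ (2 : ℤ) ∣ a₁ := fun h => ha2 (by rw [ha₁, pow_two]; exact mul_dvd_mul_left _ h)
  intro hD
  have hG : (4 : ℤ) ∣ b₁ ^ 2 * g.c ^ 2 - 2 * a₁ * g.c ^ 3 - 8 * b₁ ^ 3 * g.d - 27 * a₁ ^ 2 * g.d ^ 2 +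
      18 * a₁ * b₁ * g.c * g.d := by
    have h16 : (16 : ℤ) ∣ g.disc := by simpa using hD
    have : g.disc = 4 * (b₁ ^ 2 * g.c ^ 2 - 2 * a₁ * g.c ^ 3 - 8 * b₁ ^ 3 * g.d - 27 * a₁ ^ 2 * g.d ^ 2 +
        18 * a₁ * b₁ * g.c * g.d) := by rw [disc_eq, ha₁, hb₁]; ring
    rw [this, show (16 : ℤ) = 4 * 4 by norm_num] at h16
    exact (mul_dvd_mul_iff_left (by norm_num)).mp h16
  have h1 : (2 : ZMod 4) * (a₁ : ZMod 4) ≠ 0 := by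
    intro h
    have h' : (((2 * a₁ : ℤ)) : ZMod 4) = 0 := by push_cast; exact h
    rw [ZMod.intCast_zmod_eq_zero_iff_dvd] at h'
    exact ha₁' (by omega)
  have h2 : (2 : ZMod 4) * (g.c : ZMod 4) ≠ 0 := by
    intro h
    have h' : (((2 * g.c : ℤ)) : ZMod 4) = 0 := by push_cast; exact h
    rw [ZMod.intCast_zmod_eq_zero_iff_dvd] at h'
    exact hc (by omega)
  refine ne_zero_zmod_four (a₁ : ZMod 4) (b₁ : ZMod 4) (g.c : ZMod 4) (g.d : ZMod 4) h1 h2 ?_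
  have := (ZMod.intCast_zmod_eq_zero_iff_dvd _ 4).mpr hG
  push_cast at this
  exact this

/-- The case `p ∥ a`, `p ∣ b`, `p ∣ c`, `p ∤ d` for `p ≠ 3`: `p³ ∤ Disc`. [folklore] -/
theorem not_cube_dvd_disc_of_dvd_c (hp : p.Prime) (hp3 : p ≠ 3) {g : BinaryCubic ℤ}
    (ha : (p : ℤ) ∣ g.a) (ha2 : ¬ (p : ℤ) ^ 2 ∣ g.a) (hb : (p : ℤ) ∣ g.b) (hc : (p : ℤ) ∣ g.c)
    (hd : ¬ (p : ℤ) ∣ g.d) : ¬ (p : ℤ) ^ 3 ∣ g.disc := by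
  have hp' : Prime (p : ℤ) := Nat.prime_iff_prime_int.mp hp
  obtain ⟨a₁, ha₁⟩ := ha
  obtain ⟨b₁, hb₁⟩ := hb
  obtain ⟨c₁, hc₁⟩ := hc
  have ha₁' : ¬ (p : ℤ) ∣ a₁ := fun h => ha2 (by rw [ha₁, pow_two]; exact mul_dvd_mul_left _ h)
  intro hD
  have hE : (p : ℤ) ^ 3 ∣ (p : ℤ) ^ 2 * (27 * a₁ ^ 2 * g.d ^ 2) := by
    have : (p : ℤ) ^ 2 * (27 * a₁ ^ 2 * g.d ^ 2) = (p : ℤ) ^ 3 *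
        (p * b₁ ^ 2 * c₁ ^ 2 - 4 * p * a₁ * c₁ ^ 3 - 4 * b₁ ^ 3 * g.d + 18 * a₁ * b₁ * c₁ * g.d) - g.disc := by
      rw [disc_eq, ha₁, hb₁, hc₁]; ring
    rw [this]
    exact dvd_sub (dvd_mul_right _ _) hD
  rw [pow_succ, mul_dvd_mul_iff_left (pow_ne_zero 2 hp'.ne_zero)] at hE
  rcases hp'.dvd_or_dvd hE with h | h
  · rcases hp'.dvd_or_dvd h with h | h
    · -- `p ∣ 27`
      have h27 : (p : ℤ) ∣ 3 ^ 3 := by simpa using h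
      have h3 := hp'.dvd_of_dvd_pow h27
      have h3' : (p : ℤ) ≤ 3 := Int.le_of_dvd (by norm_num) h3
      have h2p := hp.two_le
      have hp2 : p = 2 := by omega
      subst hp2
      norm_num at h3
    · exact ha₁' (hp'.dvd_of_dvd_pow h)
  · exact hd (hp'.dvd_of_dvd_pow h)

/-- The case `3 ∥ a`, `3 ∣ b`, `3 ∣ c`, `3 ∤ d`: `3⁶ ∤ Disc` (a three-step descent). [folklore] -/
theorem not_three_pow_six_dvd_disc {g : BinaryCubic ℤ} (ha : (3 : ℤ) ∣ g.a) (ha2 : ¬ (3 : ℤ) ^ 2 ∣ g.a)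
    (hb : (3 : ℤ) ∣ g.b) (hc : (3 : ℤ) ∣ g.c) (hd : ¬ (3 : ℤ) ∣ g.d) : ¬ (3 : ℤ) ^ 6 ∣ g.disc := by
  have hp' : Prime (3 : ℤ) := Int.prime_three
  obtain ⟨a₁, ha₁⟩ := ha
  obtain ⟨b₁, hb₁⟩ := hb
  obtain ⟨c₁, hc₁⟩ := hc
  have ha₁' : ¬ (3 : ℤ) ∣ a₁ := fun h => ha2 (by rw [ha₁, pow_two]; exact mul_dvd_mul_left _ h)
  intro hD
  -- `Disc = 27 · E'` with `E' = 3b₁²c₁² − 12a₁c₁³ − 4b₁³d + 18a₁b₁c₁d − 9a₁²d²`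
  set E : ℤ := 3 * b₁ ^ 2 * c₁ ^ 2 - 12 * a₁ * c₁ ^ 3 - 4 * b₁ ^ 3 * g.d + 18 * a₁ * b₁ * c₁ * g.d -
    9 * a₁ ^ 2 * g.d ^ 2 with hE_def
  have hE : (27 : ℤ) ∣ E := by
    have h729 : (729 : ℤ) ∣ g.disc := by simpa using hD
    have : g.disc = 27 * E := by rw [disc_eq, ha₁, hb₁, hc₁, hE_def]; ring
    rw [this, show (729 : ℤ) = 27 * 27 by norm_num] at h729
    exact (mul_dvd_mul_iff_left (by norm_num)).mp h729
  -- step 1: `3 ∣ b₁`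
  have hb3 : (3 : ℤ) ∣ b₁ := by
    have h1 : (3 : ℤ) ∣ 4 * b₁ ^ 3 * g.d := by
      have : 4 * b₁ ^ 3 * g.d = 3 * (b₁ ^ 2 * c₁ ^ 2 - 4 * a₁ * c₁ ^ 3 + 6 * a₁ * b₁ * c₁ * g.d -
          3 * a₁ ^ 2 * g.d ^ 2) - E := by rw [hE_def]; ring
      rw [this]
      exact dvd_sub (dvd_mul_right _ _) (dvd_trans ⟨9, by norm_num⟩ hE)
    rcases hp'.dvd_or_dvd h1 with h | h
    · rcases hp'.dvd_or_dvd h with h | h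
      · norm_num at h
      · exact hp'.dvd_of_dvd_pow h
    · exact absurd h hd
  obtain ⟨b₂, hb₂⟩ := hb3
  -- step 2: `3 ∣ c₁`
  have hc3 : (3 : ℤ) ∣ c₁ := by
    have h1 : (9 : ℤ) ∣ 12 * a₁ * c₁ ^ 3 := by
      have : 12 * a₁ * c₁ ^ 3 = 9 * (-12 * b₂ ^ 3 * g.d + 3 * b₂ ^ 2 * c₁ ^ 2 + 6 * a₁ * b₂ * c₁ * g.d -
          a₁ ^ 2 * g.d ^ 2) - E := by rw [hE_def, hb₂]; ring
      rw [this]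
      exact dvd_sub (dvd_mul_right _ _) (dvd_trans ⟨3, by norm_num⟩ hE)
    have h2 : (3 : ℤ) ∣ 4 * (a₁ * c₁ ^ 3) := by
      set t : ℤ := a₁ * c₁ ^ 3 with ht
      have h1' : (9 : ℤ) ∣ 12 * t := by rw [ht, ← mul_assoc]; exact h1
      omega
    rcases hp'.dvd_or_dvd h2 with h | h
    · norm_num at h
    · rcases hp'.dvd_or_dvd h with h | h
      · exact absurd h ha₁'
      · exact hp'.dvd_of_dvd_pow h
  obtain ⟨c₂, hc₂⟩ := hc3
  -- step 3: `3 ∣ a₁ d`, contradiction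
  have h1 : (27 : ℤ) ∣ 9 * a₁ ^ 2 * g.d ^ 2 := by
    have : 9 * a₁ ^ 2 * g.d ^ 2 = 27 * (-12 * a₁ * c₂ ^ 3 - 4 * b₂ ^ 3 * g.d + 9 * b₂ ^ 2 * c₂ ^ 2 +
        6 * a₁ * b₂ * c₂ * g.d) - E := by rw [hE_def, hb₂, hc₂]; ring
    rw [this]
    exact dvd_sub (dvd_mul_right _ _) hE
  have h2 : (3 : ℤ) ∣ a₁ ^ 2 * g.d ^ 2 := by
    set t : ℤ := a₁ ^ 2 * g.d ^ 2 with ht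
    have h1' : (27 : ℤ) ∣ 9 * t := by rw [ht, ← mul_assoc]; exact h1
    omega
  rcases hp'.dvd_or_dvd h2 with h | h
  · exact ha₁' (hp'.dvd_of_dvd_pow h)
  · exact hd (hp'.dvd_of_dvd_pow h)

/-- **Davenport–Heilbronn: the discriminant of a form in `U_p` has bounded `p`-adic valuation**:
`p³ ∤ Disc f` for `p ≥ 5`, `2⁴ ∤ Disc f`, `3⁶ ∤ Disc f` (`v_p(Disc) ≤ 2`, `v_2 ≤ 3`, `v_3 ≤ 5`;
Davenport–Heilbronn 1971, `U_p ⊂ V_p`; for cubic fields Hasse 1930 / Taniguchi–Thorne 2013 §6.2).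
Proof: a `GL₂(ℤ)`-translate has `p ∥ a`, `p ∣ b` (the multiple root at `(1:0)`, and `p² ∤ a` by
`U_p`), and then the valuation is read off `Disc = b²c² − 4ac³ − 4b³d − 27a²d² + 18abcd`. [folklore] -/
theorem not_pow_dvd_disc_of_memU (hp : p.Prime) (hU : f.MemU p) :
    ¬ (p : ℤ) ^ (if p = 2 then 4 else if p = 3 then 6 else 3) ∣ f.disc := by
  have hp' : Prime (p : ℤ) := Nat.prime_iff_prime_int.mp hp
  have hk : 2 ≤ (if p = 2 then 4 else if p = 3 then 6 else 3) ∧ (p ≠ 3 → 3 ≤ (if p = 2 then 4 else if p = 3 then 6 else 3)) := by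
    split_ifs <;> simp_all
  intro h
  have hD : (p : ℤ) ∣ f.disc := (dvd_pow_self _ (by omega)).trans h
  obtain ⟨g, hfg, hga, hgb⟩ := exists_gl2zEquiv_dvd_a_dvd_b hp hU.1 hD
  have hUg : g.MemU p := hU.of_gl2zEquiv hfg
  have hga2 : ¬ (p : ℤ) ^ 2 ∣ g.a := fun h2 => hUg.2 ⟨g, GL2ZEquiv.refl g, h2, hgb⟩
  rw [← hfg.disc_eq] at h
  by_cases hgc : (p : ℤ) ∣ g.c
  · have hgd : ¬ (p : ℤ) ∣ g.d := fun hgd => hUg.1 ⟨hga, hgb, hgc, hgd⟩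
    by_cases h3 : p = 3
    · subst h3
      exact not_three_pow_six_dvd_disc hga hga2 hgb hgc hgd (by simpa using h)
    · exact not_cube_dvd_disc_of_dvd_c hp h3 hga hga2 hgb hgc hgd ((pow_dvd_pow _ (hk.2 h3)).trans h)
  · by_cases h2 : p = 2
    · subst h2
      exact not_two_pow_four_dvd_disc hga hga2 hgb hgc (by simpa using h)
    · exact not_sq_dvd_disc_of_not_dvd_c hp h2 hga hga2 hgb hgc ((pow_dvd_pow _ hk.1).trans h)

/-- In particular `Disc f ≠ 0` for `f ∈ U_p`. [folklore] -/
theorem disc_ne_zero_of_memU (hp : p.Prime) (hU : f.MemU p) : f.disc ≠ 0 := fun h0 =>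
  not_pow_dvd_disc_of_memU hp hU (by rw [h0]; exact dvd_zero _)

/-- The three cases spelled out: `p³ ∤ Disc` for primes `p ≥ 5`. [folklore] -/
theorem not_cube_dvd_disc_of_memU (hp : p.Prime) (hp5 : 5 ≤ p) (hU : f.MemU p) :
    ¬ (p : ℤ) ^ 3 ∣ f.disc := by
  have := not_pow_dvd_disc_of_memU hp hU
  rwa [if_neg (by omega), if_neg (by omega)] at this

/-- `2⁴ ∤ Disc f` for `f ∈ U_2`. [folklore] -/
theorem not_two_pow_four_dvd_disc_of_memU (hU : f.MemU 2) : ¬ (2 : ℤ) ^ 4 ∣ f.disc := by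
  simpa using not_pow_dvd_disc_of_memU Nat.prime_two hU

/-- `3⁶ ∤ Disc f` for `f ∈ U_3`. [folklore] -/
theorem not_three_pow_six_dvd_disc_of_memU (hU : f.MemU 3) : ¬ (3 : ℤ) ^ 6 ∣ f.disc := by
  simpa using not_pow_dvd_disc_of_memU Nat.prime_three hU

end BinaryCubic

namespace RingOfForm

open BinaryCubic

variable {f : BinaryCubic ℤ}

/-- **The discriminant of a maximal cubic ring `R(f)`**: `p³ ∤ Disc` for every prime `p ≥ 5`,
`2⁴ ∤ Disc`, `3⁶ ∤ Disc` (through `f ∈ U_p` for all `p`, BTT Prop. 2.2; for the maximal order of a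
cubic field this is the classical shape of cubic discriminants). [folklore] -/
theorem IsMaximal.not_pow_dvd_disc (hf : IsMaximal f) {p : ℕ} (hp : p.Prime) :
    ¬ (p : ℤ) ^ (if p = 2 then 4 else if p = 3 then 6 else 3) ∣ f.disc :=
  not_pow_dvd_disc_of_memU hp (memU_of_isMaximal hf hp.one_lt)

/-- On the absolute value: for maximal `R(f)` and a prime `p`, `p ^ (if p = 2 then 4 else if p = 3 then 6 else 3) ∤ |Disc f|`. [folklore] -/
theorem IsMaximal.not_pow_dvd_natAbs_disc (hf : IsMaximal f) {p : ℕ} (hp : p.Prime) :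
    ¬ p ^ (if p = 2 then 4 else if p = 3 then 6 else 3) ∣ f.disc.natAbs := by
  rw [← Int.ofNat_dvd_left, Nat.cast_pow]
  exact hf.not_pow_dvd_disc hp

/-- A maximal cubic ring is nondegenerate: `Disc ≠ 0`. [folklore] -/
theorem IsMaximal.disc_ne_zero (hf : IsMaximal f) : f.disc ≠ 0 :=
  disc_ne_zero_of_memU Nat.prime_two (memU_of_isMaximal hf (by norm_num))

end RingOfForm

end Literature.NumberTheory.CubicFields
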